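import Summits.QuantumFields.YangMills.Theorems.FluctuationComparisonRegPrIntLS2BetaStrataOfLetters
import Summits.QuantumFields.YangMills.Theorems.FluctuationComparisonRegPrIntLS2BetaOrbitDistComparison
import HarnessLib

/-!
# S2β ∕ GAP♯∘ strata residue (H′) — THE GAUGED LETTERS: GAP♯∘ ⟸ (D♮) «a residual relative gauge exists» + (F♮) «first-order pairing
# against the PLAIN distance to the background», on the two strata (repair of the letter texts of ✓`…S2BetaStrataOfLetters`)

Cell `ym3-torus` (YM ladder rung R3 = continuum `SU(2)` Yang–Mills on the three-torus — a RUNG: NOT d = 4, NOT infinite volume,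
NOT a mass gap, NOT Clay).  Width seat «width 16» `ym3-torus-px16` (gen 21), FREE px helper on crux `stmt-QuantumFields-20520`
(`FluctuationComparisonRegPrIntL`), count-neutral, DEFINITION-FREE, default heartbeats.

WHY.  The pairing letter (F) of ✓`…S2BetaStrataOfLetters` bounds `−LIN(U;U₀)` by `c·x + ¼·REL(U;U₀)` with `x` the distance of `U` to the
RESIDUAL ORBIT of the argmin `U₀`.  `LIN` and `REL` are NOT invariant under moving `U` along that orbit while `x` and the excess are: at the
pure-gauge test field `U := w•U₀` (`w` residual) one has `x = 0`, `A(U) = A(U₀)`, and by the exact split ✓`wilsonAction4_sub_eq`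
`−LIN = Σ_p reTr(U₀(∂p))·(1 − reTr E_p) ≥ (7∕8)·REL`, so (F) there forces `REL(w•U₀; U₀) = 0`, i.e. every residual `w` FIXES every
plaquette of `U₀` — false at any non-flat background (companion file `…S2BetaPairingLetterPureGaugeTest`).  UV3-NODE §75.2's mechanism
(`|LIN| ≲ θ_J·L^{−2(K−J)}·d(U,U₀)²` through constrained criticality) bounds `LIN` by the distance to `U₀` ITSELF.  The repair costs
nothing downstream: GAP♯∘'s body is gauge invariant, so the floor argument may be run at ANY representative of the orbit.

WHAT (theorems only; no `def`, no `instance`, no `sorry`).  With `N⁻² := ((F.L : ℝ)⁻¹)^(2(K−J))`, `E_p := (U₀(∂p))⁻¹·U(∂p)`,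
`REL(U;U₀) := Σ_p (1 − reTr E_p)`, `LIN(U;U₀) := Σ_p ⟪imVec q(U₀(∂p)), imVec q(E_p)⟫`, `d²(U,U₀) := Σ_ℓ dist1(U ℓ·(U₀ ℓ)⁻¹)²`:
* (D♮) «RELATIVE GAUGE» — prefix of ✓(D10), then `∃ γ₁ > 0, ∃ C_D > 0, ∀ F γ …, ∀ U₀ ∈ argmin, ∀ U ∈ fibre ∩ histGood,`
  `∃ w residual, N⁻²·d²(U, w•U₀) ≤ C_D·REL(U; w•U₀)` — the shape the relative telescoped road (REL-TEL, §75.3) delivers: SOME residual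
  re-gauging of the background (equivalently of `U`) in which the `ℓ²` distance is controlled by the relative plaquette action;
* (F♮) «PAIRING, PLAIN DISTANCE» — prefix, then `∀ c > 0, ∃ γ₁ > 0, ∀ F γ …, ∀ U₀ ∈ argmin, ∀ U ∈ fibre ∩ histGood,`
  `−LIN(U;U₀) ≤ c·N⁻²·d²(U,U₀) + ¼·REL(U;U₀)` — §75.2 (b)–(d) verbatim ({CRIT-m, MULT, AVG₂, BKG}), consistent with the pure-gauge test.
★★★ `gapStratum_of_gaugedLetters (G) (hD) (hF)`: the common body of `hIrr` ∕ `hA` (arbitrary stratum guard `G`, conclusion = that of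
✓`gapStratum_of_letters` VERBATIM, `μ := 1∕(2C_D)`).  PROOF: take the residual `w` of (D♮); `U₀′ := w•U₀` is again an argmin point
(✓`gaugeAct_mem_argmin_iff_of_residual`: fibre, good history and action are invariant); apply (F♮) and the (E)-shape ✓`relAction_le_excess_sub_lin`
at `(U₀′, U)` (`dist1 U₀′(∂p) ≤ θBal(K) ≤ ½`); ✓`gap_algebra` gives `N⁻²·d²(U,U₀′)∕(2C_D) ≤ A(U) − A(U₀′)`; finally
`x = N⁻²·⨅_w d²(U, w•U₀) ≤ N⁻²·d²(U, U₀′)` (✓`iInf_orbitDistSq_le_of_residual`).  ★★★ `uniformFibreGapOrbit_of_gaugedLetters (hD₁ hF₁ hD₂ hF₂)`: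
GAP♯∘'s v11.4 text VERBATIM from the four gauged letters, ONE TERM through ✓`uniformFibreGapOrbit_of_strata` (px17 g19's ✓`hFlat_holds` inside).

HONEST SCOPE.  A DOOR (bookkeeping over landed RG-K letters): (D♮), (F♮) are HYPOTHESES (UV3-NODE §75.4: (D♮) = REL-TEL, L-sized, road
known; (F♮) = {CRIT-m, MULT, AVG₂, BKG}); nothing of Bałaban's analysis is asserted or proved; `hIrr`, `hA`, TUBE-REG∘, GAP♯∘
(`stub_uniformFibreGapOrbit`), S2β, the five registered stubs of `Lines/semiclassical_s2beta.lean` (3732b7df), crux 20520, 19936, 19200 and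
`YM3TorusSU2` are NOT proved; no registered stub is closed; the Yang–Mills mass gap is NOT proved.  Sorry-free, axioms standard.

References: T. Bałaban, CMP **102** (1985) 277–309 [Balaban1985Variational] (Thm 1 (8)–(10) p.279; (4) p.278 the residual group;
(142) p.299); CMP **102** (1985) 255–275 [Balaban1985UV3] ((7) p.257).
-/

set_option autoImplicit false

noncomputable section

open Set Function
open scoped Matrix.Norms.L2Operator RealInnerProductSpace
open Literature.MathematicalPhysics.QuantumLattice (su2Quat)
open Literature.MathematicalPhysics.QuantumFieldTheory.Balaban1983to89
open Literature.MathematicalPhysics.QuantumFieldTheory.Balaban1983to89.T4Continuum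
open Literature.MathematicalPhysics.QuantumFieldTheory.Balaban1983to89.B10Eq27TorusAxialLog (unitsField toUField)
open Literature.MathematicalPhysics.QuantumFieldTheory.Balaban1983to89.B9AdOrthogonal (σ₃)
open Literature.MathematicalPhysics.QuantumFieldTheory.Balaban1983to89.T3ContinuumYM3Torus
open Literature.MathematicalPhysics.QuantumFieldTheory.Balaban1983to89.T3UnitLawDensityEML (ℰp)
open Literature.MathematicalPhysics.QuantumFieldTheory.Balaban1983to89.T3UnitScaleTilt
open Literature.MathematicalPhysics.QuantumFieldTheory.Balaban1983to89.T3TiltDescent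
open Literature.MathematicalPhysics.QuantumFieldTheory.Balaban1983to89.T3Thresholds (exists_gamma_forall_θBal_le)
open Literature.MathematicalPhysics.QuantumFieldTheory.Balaban1983to89.T3ConstrainedMinimiser (fibre)
open Literature.MathematicalPhysics.QuantumFieldTheory.Balaban1983to89.T3PrintedRegularMinimiser
open Literature.MathematicalPhysics.QuantumFieldTheory.Balaban1983to89.T3PrintedRegularOrbits
open Literature.MathematicalPhysics.QuantumFieldTheory.Balaban1983to89.T4ExpWindowSmallField (imVec)
open Summit.QuantumFields.YangMills.Theorems.FluctuationComparisonRegPrIntLS2BetaExcessSplit (relAction_le_excess_sub_lin)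
open Summit.QuantumFields.YangMills.Theorems.FluctuationComparisonRegPrIntLS2BetaGapOrbitOfStrataTwo (uniformFibreGapOrbit_of_strata)
open Summit.QuantumFields.YangMills.Theorems.FluctuationComparisonRegPrIntLS2BetaStrataOfLetters (gap_algebra dist1_plaqHol_lt_of_mem_histGood_zero)
open Summit.QuantumFields.YangMills.Theorems.FluctuationComparisonRegPrIntLS2BetaResidualGauge (gaugeAct_mem_argmin_iff_of_residual)
open Summit.QuantumFields.YangMills.Theorems.FluctuationComparisonRegPrIntLS2BetaOrbitDistComparison (iInf_orbitDistSq_le_of_residual)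

namespace Summit.QuantumFields.YangMills.Theorems.FluctuationComparisonRegPrIntLS2BetaStrataOfGaugedLetters

/-! ## §0 The (D♮) letter is shape-agnostic: re-gauging the FIELD (print's relative axial gauge) or the BACKGROUND is the same letter -/

/-- The relative plaquette `E_p` read against a re-gauged background is the conjugate of the one read after re-gauging the field the
opposite way: `reTr(((w⁻¹•U₀)(∂p))⁻¹·U(∂p)) = reTr((U₀(∂p))⁻¹·(w•U)(∂p))`. [cite: Balaban1985Averaging, (8)-(9) p.19] -/
theorem reTr_rel_gaugeAct_inv_eq {P : Params} {j : ℕ} (w : Site P j → Matrix.specialUnitaryGroup (Fin 2) ℂ)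
    (U U₀ : GaugeField P j (Matrix.specialUnitaryGroup (Fin 2) ℂ)) (p : Plaq P j) :
    reTr ((GaugeField.plaqHol (GaugeField.gaugeAct (w⁻¹ : Site P j → Matrix.specialUnitaryGroup (Fin 2) ℂ) U₀) p)⁻¹ * GaugeField.plaqHol U p) =
      reTr ((GaugeField.plaqHol U₀ p)⁻¹ * GaugeField.plaqHol (GaugeField.gaugeAct w U) p) := by
  rw [T4WilsonGaugeFlatDirection.plaqHol_gaugeAct, T4WilsonGaugeFlatDirection.plaqHol_gaugeAct]
  have h : ((w⁻¹ : Site P j → Matrix.specialUnitaryGroup (Fin 2) ℂ) p.src * GaugeField.plaqHol U₀ p *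
        ((w⁻¹ : Site P j → Matrix.specialUnitaryGroup (Fin 2) ℂ) p.src)⁻¹)⁻¹ * GaugeField.plaqHol U p =
      (w p.src)⁻¹ * ((GaugeField.plaqHol U₀ p)⁻¹ * (w p.src * GaugeField.plaqHol U p * (w p.src)⁻¹)) * ((w p.src)⁻¹)⁻¹ := by
    simp only [Pi.inv_apply]
    group
  rw [h, GaugeGroup.reTr_conj]

/-- ★ **(D♮) IN PRINT'S SHAPE ⟹ (D♮) AS CONSUMED BY THE DOOR** (pair level): if SOME residual re-gauging `w•U` of the field has
`N⁻²·d²(w•U, U₀) ≤ C_D·REL(w•U; U₀)`, then the residual `w⁻¹` re-gauges the background with `N⁻²·d²(U, w⁻¹•U₀) ≤ C_D·REL(U; w⁻¹•U₀)`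
(`d²` is invariant under a common gauge transformation, ✓`sum_dist1_sq_gaugeAct`; the residual set is a group, ✓`residual_inv`).
[cite: Balaban1985Variational, (4) p.278, (10) p.279] -/
theorem relGauge_background_of_field (F : T3Family) {J K : ℕ} (hJK : J ≤ K) {N2 C_D : ℝ}
    (U U₀ : GaugeField (F.P K) 0 (Matrix.specialUnitaryGroup (Fin 2) ℂ)) {w : Site (F.P K) 0 → Matrix.specialUnitaryGroup (Fin 2) ℂ}
    (hw : ∀ U' : GaugeField (F.P K) 0 (Matrix.specialUnitaryGroup (Fin 2) ℂ),
      descendTo F ℰp J K hJK (GaugeField.gaugeAct w U') = descendTo F ℰp J K hJK U')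
    (h : N2 * ∑ ℓ : PBond (F.P K) 0, dist1 ((GaugeField.gaugeAct w U) ℓ * (U₀ ℓ)⁻¹) ^ 2
      ≤ C_D * ∑ p : Plaq (F.P K) 0, (1 - reTr ((GaugeField.plaqHol U₀ p)⁻¹ * GaugeField.plaqHol (GaugeField.gaugeAct w U) p))) :
    ∃ w' : GaugeTransf (F.P K) 0 (Matrix.specialUnitaryGroup (Fin 2) ℂ),
      (∀ U' : GaugeField (F.P K) 0 (Matrix.specialUnitaryGroup (Fin 2) ℂ),
        descendTo F ℰp J K hJK (GaugeField.gaugeAct w' U') = descendTo F ℰp J K hJK U') ∧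
      N2 * ∑ ℓ : PBond (F.P K) 0, dist1 (U ℓ * ((GaugeField.gaugeAct w' U₀) ℓ)⁻¹) ^ 2
        ≤ C_D * ∑ p : Plaq (F.P K) 0, (1 - reTr ((GaugeField.plaqHol (GaugeField.gaugeAct w' U₀) p)⁻¹ * GaugeField.plaqHol U p)) := by
  refine ⟨(w⁻¹ : Site (F.P K) 0 → Matrix.specialUnitaryGroup (Fin 2) ℂ),
    FluctuationComparisonRegPrIntLS2BetaResidualGauge.residual_inv F hJK hw, ?_⟩
  have hd : ∑ ℓ : PBond (F.P K) 0, dist1 (U ℓ * ((GaugeField.gaugeAct (w⁻¹ : Site (F.P K) 0 → Matrix.specialUnitaryGroup (Fin 2) ℂ) U₀) ℓ)⁻¹) ^ 2 =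
      ∑ ℓ : PBond (F.P K) 0, dist1 ((GaugeField.gaugeAct w U) ℓ * (U₀ ℓ)⁻¹) ^ 2 := by
    rw [← FluctuationComparisonRegPrIntLS2BetaOrbitDistComparison.sum_dist1_sq_gaugeAct w U,
      FluctuationComparisonRegPrIntLS2BetaResidualGauge.gaugeAct_gaugeAct_inv]
  have hr : ∑ p : Plaq (F.P K) 0, (1 - reTr ((GaugeField.plaqHol (GaugeField.gaugeAct (w⁻¹ : Site (F.P K) 0 → Matrix.specialUnitaryGroup (Fin 2) ℂ) U₀) p)⁻¹ * GaugeField.plaqHol U p)) =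
      ∑ p : Plaq (F.P K) 0, (1 - reTr ((GaugeField.plaqHol U₀ p)⁻¹ * GaugeField.plaqHol (GaugeField.gaugeAct w U) p)) :=
    Finset.sum_congr rfl fun p _ => by rw [reTr_rel_gaugeAct_inv_eq]
  rw [hd, hr]
  exact h

/-! ## §1 The door with an arbitrary stratum guard -/

/-- ★★★ **THE STRATUM GAP BODY FROM THE TWO GAUGED LETTERS, ARBITRARY GUARD `G`.**  Prefix, argmin set, fibre ∕ good-history binders and
conclusion = those of ✓`…S2BetaStrataOfLetters.gapStratum_of_letters` VERBATIM; hypotheses (D♮) «a residual relative gauge with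
`N⁻²·d²(U, w•U₀) ≤ C_D·REL(U; w•U₀)`» and (F♮) «`−LIN(U;U₀) ≤ c·N⁻²·d²(U,U₀) + ¼·REL(U;U₀)` at every argmin ∕ field pair»; `μ := 1∕(2C_D)`.
[cite: Balaban1985Variational, Thm 1 (8)-(10) p.279, (4) p.278, (142) p.299; Balaban1985UV3, (7) p.257] -/
theorem gapStratum_of_gaugedLetters
    (G : (F : T3Family) → (J : ℕ) → GaugeField (F.P J) 0 (Matrix.specialUnitaryGroup (Fin 2) ℂ) → Prop)
    (hD : ∀ (L : ℕ), ∃ c₀ : ℝ, 0 < c₀ ∧ c₀ ≤ 1 ∧ ∀ (cw : ℝ), 0 < cw → cw ≤ c₀ → ∃ pS : ℝ, ∀ (b₀ p₀ : ℝ), 0 < b₀ → pS ≤ p₀ → 0 < p₀ → ∃ ε₁ : ℝ, 0 < ε₁ ∧ ∀ (ε₀ : ℝ), 0 < ε₀ → ε₀ ≤ ε₁ →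
    ∃ γ₁ : ℝ, 0 < γ₁ ∧ ∃ C_D : ℝ, 0 < C_D ∧ ∀ (F : T3Family) (γ : ℝ), F.L = L → 0 < γ → γ ≤ γ₁ →
      ∀ (J K : ℕ) (hJK : J ≤ K) (V : GaugeField (F.P J) 0 (Matrix.specialUnitaryGroup (Fin 2) ℂ)), PlaqSmall (θBal F.L γ (cw * b₀) p₀ J) V →
        G F J V →
        ∀ U₀ ∈ {U' : GaugeField (F.P K) 0 (Matrix.specialUnitaryGroup (Fin 2) ℂ) | U' ∈ fibre F ℰp J K hJK V ∧ U' ∈ histGood F ℰp (θBal F.L γ b₀ p₀) K J ∧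
            wilsonAction4 U' = minActionRegPr F J K hJK ε₀ V},
        ∀ U ∈ fibre F ℰp J K hJK V, U ∈ histGood F ℰp (θBal F.L γ b₀ p₀) K J →
          ∃ w : GaugeTransf (F.P K) 0 (Matrix.specialUnitaryGroup (Fin 2) ℂ),
            (∀ U' : GaugeField (F.P K) 0 (Matrix.specialUnitaryGroup (Fin 2) ℂ),
              descendTo F ℰp J K hJK (GaugeField.gaugeAct w U') = descendTo F ℰp J K hJK U') ∧
            ((F.L : ℝ)⁻¹) ^ (2 * (K - J)) * ∑ ℓ : PBond (F.P K) 0, dist1 (U ℓ * ((GaugeField.gaugeAct w U₀) ℓ)⁻¹) ^ 2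
              ≤ C_D * ∑ p : Plaq (F.P K) 0, (1 - reTr ((GaugeField.plaqHol (GaugeField.gaugeAct w U₀) p)⁻¹ * GaugeField.plaqHol U p)))
    (hF : ∀ (L : ℕ), ∃ c₀ : ℝ, 0 < c₀ ∧ c₀ ≤ 1 ∧ ∀ (cw : ℝ), 0 < cw → cw ≤ c₀ → ∃ pS : ℝ, ∀ (b₀ p₀ : ℝ), 0 < b₀ → pS ≤ p₀ → 0 < p₀ → ∃ ε₁ : ℝ, 0 < ε₁ ∧ ∀ (ε₀ : ℝ), 0 < ε₀ → ε₀ ≤ ε₁ →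
    ∀ (c : ℝ), 0 < c → ∃ γ₁ : ℝ, 0 < γ₁ ∧ ∀ (F : T3Family) (γ : ℝ), F.L = L → 0 < γ → γ ≤ γ₁ →
      ∀ (J K : ℕ) (hJK : J ≤ K) (V : GaugeField (F.P J) 0 (Matrix.specialUnitaryGroup (Fin 2) ℂ)), PlaqSmall (θBal F.L γ (cw * b₀) p₀ J) V →
        G F J V →
        ∀ U₀ ∈ {U' : GaugeField (F.P K) 0 (Matrix.specialUnitaryGroup (Fin 2) ℂ) | U' ∈ fibre F ℰp J K hJK V ∧ U' ∈ histGood F ℰp (θBal F.L γ b₀ p₀) K J ∧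
            wilsonAction4 U' = minActionRegPr F J K hJK ε₀ V},
        ∀ U ∈ fibre F ℰp J K hJK V, U ∈ histGood F ℰp (θBal F.L γ b₀ p₀) K J →
          -(∑ p : Plaq (F.P K) 0,
              inner ℝ (imVec (su2Quat (GaugeField.plaqHol U₀ p))) (imVec (su2Quat ((GaugeField.plaqHol U₀ p)⁻¹ * GaugeField.plaqHol U p))))
            ≤ c * (((F.L : ℝ)⁻¹) ^ (2 * (K - J)) * ∑ ℓ : PBond (F.P K) 0, dist1 (U ℓ * (U₀ ℓ)⁻¹) ^ 2) +
              1 / 4 * ∑ p : Plaq (F.P K) 0, (1 - reTr ((GaugeField.plaqHol U₀ p)⁻¹ * GaugeField.plaqHol U p))) :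
    ∀ (L : ℕ), ∃ c₀ : ℝ, 0 < c₀ ∧ c₀ ≤ 1 ∧ ∀ (cw : ℝ), 0 < cw → cw ≤ c₀ → ∃ pS : ℝ, ∀ (b₀ p₀ : ℝ), 0 < b₀ → pS ≤ p₀ → 0 < p₀ → ∃ ε₁ : ℝ, 0 < ε₁ ∧ ∀ (ε₀ : ℝ), 0 < ε₀ → ε₀ ≤ ε₁ →
    ∃ γ₁ : ℝ, 0 < γ₁ ∧ ∃ μ : ℝ, 0 < μ ∧ ∀ (F : T3Family) (γ : ℝ), F.L = L → 0 < γ → γ ≤ γ₁ →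
      ∀ (J K : ℕ) (hJK : J ≤ K) (V : GaugeField (F.P J) 0 (Matrix.specialUnitaryGroup (Fin 2) ℂ)), PlaqSmall (θBal F.L γ (cw * b₀) p₀ J) V →
        G F J V →
        ∀ U₀ ∈ {U' : GaugeField (F.P K) 0 (Matrix.specialUnitaryGroup (Fin 2) ℂ) | U' ∈ fibre F ℰp J K hJK V ∧ U' ∈ histGood F ℰp (θBal F.L γ b₀ p₀) K J ∧
            wilsonAction4 U' = minActionRegPr F J K hJK ε₀ V},
        ∀ U ∈ fibre F ℰp J K hJK V, U ∈ histGood F ℰp (θBal F.L γ b₀ p₀) K J →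
          μ * ((F.L : ℝ)⁻¹) ^ (2 * (K - J)) *
              (⨅ w : {w : GaugeTransf (F.P K) 0 (Matrix.specialUnitaryGroup (Fin 2) ℂ) | ∀ U : GaugeField (F.P K) 0 (Matrix.specialUnitaryGroup (Fin 2) ℂ),
                  descendTo F ℰp J K hJK (GaugeField.gaugeAct w U) = descendTo F ℰp J K hJK U}, ∑ ℓ : PBond (F.P K) 0,
                dist1 (U ℓ * ((GaugeField.gaugeAct (w : GaugeTransf (F.P K) 0 (Matrix.specialUnitaryGroup (Fin 2) ℂ)) U₀) ℓ)⁻¹) ^ 2)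
            ≤ wilsonAction4 U - minActionRegPr F J K hJK ε₀ V := by
  intro L
  obtain ⟨c₁, hc₁, hc₁1, H1⟩ := hD L
  obtain ⟨c₂, hc₂, -, H2⟩ := hF L
  refine ⟨min c₁ c₂, lt_min hc₁ hc₂, (min_le_left _ _).trans hc₁1, ?_⟩
  intro cw hcw hcwle
  obtain ⟨pS₁, H1⟩ := H1 cw hcw (hcwle.trans (min_le_left _ _))
  obtain ⟨pS₂, H2⟩ := H2 cw hcw (hcwle.trans (min_le_right _ _))
  refine ⟨max pS₁ pS₂, ?_⟩
  intro b₀ p₀ hb hpS hp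
  obtain ⟨e₁, he₁, H1⟩ := H1 b₀ p₀ hb ((le_max_left _ _).trans hpS) hp
  obtain ⟨e₂, he₂, H2⟩ := H2 b₀ p₀ hb ((le_max_right _ _).trans hpS) hp
  refine ⟨min e₁ e₂, lt_min he₁ he₂, ?_⟩
  intro ε₀ hε₀ hε₀le
  obtain ⟨γD, hγD, C_D, hCD, H1⟩ := H1 ε₀ hε₀ (hε₀le.trans (min_le_left _ _))
  obtain ⟨γF, hγF, H2⟩ := H2 ε₀ hε₀ (hε₀le.trans (min_le_right _ _)) (1 / (16 * C_D)) (by positivity)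
  obtain ⟨γc, hγc, -, hθ⟩ := exists_gamma_forall_θBal_le (b₀ := b₀) (p₀ := p₀) hb hp (σ := 1 / 2) (by norm_num)
  refine ⟨min γD (min γF γc), lt_min hγD (lt_min hγF hγc), 1 / (2 * C_D), by positivity, ?_⟩
  intro F γ hFL hγ hγle J K hJK V hV hG U₀ hU₀ U hU hUg
  -- (D♮): a residual relative gauge `w`; move the background along its residual orbit
  obtain ⟨w, hw, hDx⟩ := H1 F γ hFL hγ (hγle.trans (min_le_left _ _)) J K hJK V hV hG U₀ hU₀ U hU hUg
  have hU₀' : GaugeField.gaugeAct w U₀ ∈ {U' : GaugeField (F.P K) 0 (Matrix.specialUnitaryGroup (Fin 2) ℂ) | U' ∈ fibre F ℰp J K hJK V ∧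
      U' ∈ histGood F ℰp (θBal F.L γ b₀ p₀) K J ∧ wilsonAction4 U' = minActionRegPr F J K hJK ε₀ V} :=
    (gaugeAct_mem_argmin_iff_of_residual F hJK hw U₀ V).mpr hU₀
  -- (F♮) at the moved background
  have hFx := H2 F γ hFL hγ (hγle.trans ((min_le_right _ _).trans (min_le_left _ _))) J K hJK V hV hG _ hU₀' U hU hUg
  -- (E): the moved background's finest plaquettes are `≤ ½` (good history at level 0, `θBal(K) ≤ ½` for `γ ≤ γc`)
  have hθU₀ : ∀ p, dist1 (GaugeField.plaqHol (GaugeField.gaugeAct w U₀) p) ≤ 1 / 2 := fun p =>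
    (dist1_plaqHol_lt_of_mem_histGood_zero F hJK (θBal F.L γ b₀ p₀) hU₀'.2.1 p).le.trans
      (hθ F.L F.hL.2.le γ hγ (hγle.trans ((min_le_right _ _).trans (min_le_right _ _))) K)
  have hE := relAction_le_excess_sub_lin U (GaugeField.gaugeAct w U₀) hθU₀
  -- the four-line algebra at the moved pair, then `x ≤ N⁻²·d²(U, w•U₀)`
  have hp0 : (0 : ℝ) ≤ ((F.L : ℝ)⁻¹) ^ (2 * (K - J)) := pow_nonneg (inv_nonneg.mpr (Nat.cast_nonneg _)) _
  have hy : (0 : ℝ) ≤ ∑ ℓ : PBond (F.P K) 0, dist1 (U ℓ * ((GaugeField.gaugeAct w U₀) ℓ)⁻¹) ^ 2 :=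
    Finset.sum_nonneg fun _ _ => sq_nonneg _
  have key := gap_algebra hCD (mul_nonneg hp0 hy) hDx hE hFx
  have hxy : (⨅ w : {w : GaugeTransf (F.P K) 0 (Matrix.specialUnitaryGroup (Fin 2) ℂ) | ∀ U : GaugeField (F.P K) 0 (Matrix.specialUnitaryGroup (Fin 2) ℂ),
                  descendTo F ℰp J K hJK (GaugeField.gaugeAct w U) = descendTo F ℰp J K hJK U}, ∑ ℓ : PBond (F.P K) 0,
                dist1 (U ℓ * ((GaugeField.gaugeAct (w : GaugeTransf (F.P K) 0 (Matrix.specialUnitaryGroup (Fin 2) ℂ)) U₀) ℓ)⁻¹) ^ 2)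
      ≤ ∑ ℓ : PBond (F.P K) 0, dist1 (U ℓ * ((GaugeField.gaugeAct w U₀) ℓ)⁻¹) ^ 2 :=
    iInf_orbitDistSq_le_of_residual F hJK U U₀ hw
  rw [mul_assoc, ← hU₀'.2.2]
  have hμ : (0 : ℝ) ≤ 1 / (2 * C_D) := by positivity
  calc 1 / (2 * C_D) * (((F.L : ℝ)⁻¹) ^ (2 * (K - J)) *
          ⨅ w : {w : GaugeTransf (F.P K) 0 (Matrix.specialUnitaryGroup (Fin 2) ℂ) | ∀ U : GaugeField (F.P K) 0 (Matrix.specialUnitaryGroup (Fin 2) ℂ),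
                  descendTo F ℰp J K hJK (GaugeField.gaugeAct w U) = descendTo F ℰp J K hJK U}, ∑ ℓ : PBond (F.P K) 0,
                dist1 (U ℓ * ((GaugeField.gaugeAct (w : GaugeTransf (F.P K) 0 (Matrix.specialUnitaryGroup (Fin 2) ℂ)) U₀) ℓ)⁻¹) ^ 2)
        ≤ 1 / (2 * C_D) * (((F.L : ℝ)⁻¹) ^ (2 * (K - J)) * ∑ ℓ : PBond (F.P K) 0, dist1 (U ℓ * ((GaugeField.gaugeAct w U₀) ℓ)⁻¹) ^ 2) :=
        mul_le_mul_of_nonneg_left (mul_le_mul_of_nonneg_left hxy hp0) hμ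
    _ ≤ wilsonAction4 U - wilsonAction4 (GaugeField.gaugeAct w U₀) := key

/-! ## §2 GAP♯∘ from the four gauged letters -/

/-- ★★★ **GAP♯∘ (`UniformFibreGapOrbit`, v11.4 text VERBATIM = the conclusion of ✓`…S2BetaGapOrbitOfStrataTwo.uniformFibreGapOrbit_of_strata`)
⟸ THE FOUR GAUGED LETTERS (D♮)∕(F♮) ON THE TWO STRATA** (irreducible guard ∕ case-A′ guard of ✓(D10) pasted verbatim) — one term:
✓`uniformFibreGapOrbit_of_strata` fed with `gapStratum_of_gaugedLetters` at the two guards (`hFlat` inside is px17 g19's ✓`hFlat_holds`).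
[cite: Balaban1985Variational, Thm 1 (8)-(10) p.279, (4) p.278, (142) p.299, Prop. 7 p.299; Balaban1985UV3, (7) p.257] -/
theorem uniformFibreGapOrbit_of_gaugedLetters
    (hD₁ : ∀ (L : ℕ), ∃ c₀ : ℝ, 0 < c₀ ∧ c₀ ≤ 1 ∧ ∀ (cw : ℝ), 0 < cw → cw ≤ c₀ → ∃ pS : ℝ, ∀ (b₀ p₀ : ℝ), 0 < b₀ → pS ≤ p₀ → 0 < p₀ → ∃ ε₁ : ℝ, 0 < ε₁ ∧ ∀ (ε₀ : ℝ), 0 < ε₀ → ε₀ ≤ ε₁ →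
    ∃ γ₁ : ℝ, 0 < γ₁ ∧ ∃ C_D : ℝ, 0 < C_D ∧ ∀ (F : T3Family) (γ : ℝ), F.L = L → 0 < γ → γ ≤ γ₁ →
      ∀ (J K : ℕ) (hJK : J ≤ K) (V : GaugeField (F.P J) 0 (Matrix.specialUnitaryGroup (Fin 2) ℂ)), PlaqSmall (θBal F.L γ (cw * b₀) p₀ J) V →
        (∀ c : Site (F.P J) 0 → Matrix (Fin 2) (Fin 2) ℂ,
          (∀ e : PBond (F.P J) 0, c e.src = ((unitsField (toUField V) e : (Matrix (Fin 2) (Fin 2) ℂ)ˣ) : Matrix (Fin 2) (Fin 2) ℂ) * c e.tgt *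
            (((unitsField (toUField V) e)⁻¹ : (Matrix (Fin 2) (Fin 2) ℂ)ˣ) : Matrix (Fin 2) (Fin 2) ℂ)) →
          ∃ z : ℂ, ∀ y, c y = z • (1 : Matrix (Fin 2) (Fin 2) ℂ)) →
        ∀ U₀ ∈ {U' : GaugeField (F.P K) 0 (Matrix.specialUnitaryGroup (Fin 2) ℂ) | U' ∈ fibre F ℰp J K hJK V ∧ U' ∈ histGood F ℰp (θBal F.L γ b₀ p₀) K J ∧
            wilsonAction4 U' = minActionRegPr F J K hJK ε₀ V},
        ∀ U ∈ fibre F ℰp J K hJK V, U ∈ histGood F ℰp (θBal F.L γ b₀ p₀) K J →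
          ∃ w : GaugeTransf (F.P K) 0 (Matrix.specialUnitaryGroup (Fin 2) ℂ),
            (∀ U' : GaugeField (F.P K) 0 (Matrix.specialUnitaryGroup (Fin 2) ℂ),
              descendTo F ℰp J K hJK (GaugeField.gaugeAct w U') = descendTo F ℰp J K hJK U') ∧
            ((F.L : ℝ)⁻¹) ^ (2 * (K - J)) * ∑ ℓ : PBond (F.P K) 0, dist1 (U ℓ * ((GaugeField.gaugeAct w U₀) ℓ)⁻¹) ^ 2
              ≤ C_D * ∑ p : Plaq (F.P K) 0, (1 - reTr ((GaugeField.plaqHol (GaugeField.gaugeAct w U₀) p)⁻¹ * GaugeField.plaqHol U p)))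
    (hF₁ : ∀ (L : ℕ), ∃ c₀ : ℝ, 0 < c₀ ∧ c₀ ≤ 1 ∧ ∀ (cw : ℝ), 0 < cw → cw ≤ c₀ → ∃ pS : ℝ, ∀ (b₀ p₀ : ℝ), 0 < b₀ → pS ≤ p₀ → 0 < p₀ → ∃ ε₁ : ℝ, 0 < ε₁ ∧ ∀ (ε₀ : ℝ), 0 < ε₀ → ε₀ ≤ ε₁ →
    ∀ (c : ℝ), 0 < c → ∃ γ₁ : ℝ, 0 < γ₁ ∧ ∀ (F : T3Family) (γ : ℝ), F.L = L → 0 < γ → γ ≤ γ₁ →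
      ∀ (J K : ℕ) (hJK : J ≤ K) (V : GaugeField (F.P J) 0 (Matrix.specialUnitaryGroup (Fin 2) ℂ)), PlaqSmall (θBal F.L γ (cw * b₀) p₀ J) V →
        (∀ c : Site (F.P J) 0 → Matrix (Fin 2) (Fin 2) ℂ,
          (∀ e : PBond (F.P J) 0, c e.src = ((unitsField (toUField V) e : (Matrix (Fin 2) (Fin 2) ℂ)ˣ) : Matrix (Fin 2) (Fin 2) ℂ) * c e.tgt *
            (((unitsField (toUField V) e)⁻¹ : (Matrix (Fin 2) (Fin 2) ℂ)ˣ) : Matrix (Fin 2) (Fin 2) ℂ)) →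
          ∃ z : ℂ, ∀ y, c y = z • (1 : Matrix (Fin 2) (Fin 2) ℂ)) →
        ∀ U₀ ∈ {U' : GaugeField (F.P K) 0 (Matrix.specialUnitaryGroup (Fin 2) ℂ) | U' ∈ fibre F ℰp J K hJK V ∧ U' ∈ histGood F ℰp (θBal F.L γ b₀ p₀) K J ∧
            wilsonAction4 U' = minActionRegPr F J K hJK ε₀ V},
        ∀ U ∈ fibre F ℰp J K hJK V, U ∈ histGood F ℰp (θBal F.L γ b₀ p₀) K J →
          -(∑ p : Plaq (F.P K) 0,
              inner ℝ (imVec (su2Quat (GaugeField.plaqHol U₀ p))) (imVec (su2Quat ((GaugeField.plaqHol U₀ p)⁻¹ * GaugeField.plaqHol U p))))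
            ≤ c * (((F.L : ℝ)⁻¹) ^ (2 * (K - J)) * ∑ ℓ : PBond (F.P K) 0, dist1 (U ℓ * (U₀ ℓ)⁻¹) ^ 2) +
              1 / 4 * ∑ p : Plaq (F.P K) 0, (1 - reTr ((GaugeField.plaqHol U₀ p)⁻¹ * GaugeField.plaqHol U p)))
    (hD₂ : ∀ (L : ℕ), ∃ c₀ : ℝ, 0 < c₀ ∧ c₀ ≤ 1 ∧ ∀ (cw : ℝ), 0 < cw → cw ≤ c₀ → ∃ pS : ℝ, ∀ (b₀ p₀ : ℝ), 0 < b₀ → pS ≤ p₀ → 0 < p₀ → ∃ ε₁ : ℝ, 0 < ε₁ ∧ ∀ (ε₀ : ℝ), 0 < ε₀ → ε₀ ≤ ε₁ →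
    ∃ γ₁ : ℝ, 0 < γ₁ ∧ ∃ C_D : ℝ, 0 < C_D ∧ ∀ (F : T3Family) (γ : ℝ), F.L = L → 0 < γ → γ ≤ γ₁ →
      ∀ (J K : ℕ) (hJK : J ≤ K) (V : GaugeField (F.P J) 0 (Matrix.specialUnitaryGroup (Fin 2) ℂ)), PlaqSmall (θBal F.L γ (cw * b₀) p₀ J) V →
        (∃ g : GaugeTransf (F.P J) 0 (Matrix.specialUnitaryGroup (Fin 2) ℂ),
          (∀ e : PBond (F.P J) 0, Commute (((GaugeField.gaugeAct g V) e : Matrix.specialUnitaryGroup (Fin 2) ℂ) : Matrix (Fin 2) (Fin 2) ℂ) σ₃) ∧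
          ∀ c : Site (F.P J) 0 → Matrix (Fin 2) (Fin 2) ℂ,
            (∀ e : PBond (F.P J) 0, c e.src = ((unitsField (toUField (GaugeField.gaugeAct g V)) e : (Matrix (Fin 2) (Fin 2) ℂ)ˣ) : Matrix (Fin 2) (Fin 2) ℂ) * c e.tgt *
            (((unitsField (toUField (GaugeField.gaugeAct g V)) e)⁻¹ : (Matrix (Fin 2) (Fin 2) ℂ)ˣ) : Matrix (Fin 2) (Fin 2) ℂ)) →
            ∃ c₀ : Matrix (Fin 2) (Fin 2) ℂ, (∀ y, c y = c₀) ∧ Commute c₀ σ₃) →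
        ∀ U₀ ∈ {U' : GaugeField (F.P K) 0 (Matrix.specialUnitaryGroup (Fin 2) ℂ) | U' ∈ fibre F ℰp J K hJK V ∧ U' ∈ histGood F ℰp (θBal F.L γ b₀ p₀) K J ∧
            wilsonAction4 U' = minActionRegPr F J K hJK ε₀ V},
        ∀ U ∈ fibre F ℰp J K hJK V, U ∈ histGood F ℰp (θBal F.L γ b₀ p₀) K J →
          ∃ w : GaugeTransf (F.P K) 0 (Matrix.specialUnitaryGroup (Fin 2) ℂ),
            (∀ U' : GaugeField (F.P K) 0 (Matrix.specialUnitaryGroup (Fin 2) ℂ),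
              descendTo F ℰp J K hJK (GaugeField.gaugeAct w U') = descendTo F ℰp J K hJK U') ∧
            ((F.L : ℝ)⁻¹) ^ (2 * (K - J)) * ∑ ℓ : PBond (F.P K) 0, dist1 (U ℓ * ((GaugeField.gaugeAct w U₀) ℓ)⁻¹) ^ 2
              ≤ C_D * ∑ p : Plaq (F.P K) 0, (1 - reTr ((GaugeField.plaqHol (GaugeField.gaugeAct w U₀) p)⁻¹ * GaugeField.plaqHol U p)))
    (hF₂ : ∀ (L : ℕ), ∃ c₀ : ℝ, 0 < c₀ ∧ c₀ ≤ 1 ∧ ∀ (cw : ℝ), 0 < cw → cw ≤ c₀ → ∃ pS : ℝ, ∀ (b₀ p₀ : ℝ), 0 < b₀ → pS ≤ p₀ → 0 < p₀ → ∃ ε₁ : ℝ, 0 < ε₁ ∧ ∀ (ε₀ : ℝ), 0 < ε₀ → ε₀ ≤ ε₁ →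
    ∀ (c : ℝ), 0 < c → ∃ γ₁ : ℝ, 0 < γ₁ ∧ ∀ (F : T3Family) (γ : ℝ), F.L = L → 0 < γ → γ ≤ γ₁ →
      ∀ (J K : ℕ) (hJK : J ≤ K) (V : GaugeField (F.P J) 0 (Matrix.specialUnitaryGroup (Fin 2) ℂ)), PlaqSmall (θBal F.L γ (cw * b₀) p₀ J) V →
        (∃ g : GaugeTransf (F.P J) 0 (Matrix.specialUnitaryGroup (Fin 2) ℂ),
          (∀ e : PBond (F.P J) 0, Commute (((GaugeField.gaugeAct g V) e : Matrix.specialUnitaryGroup (Fin 2) ℂ) : Matrix (Fin 2) (Fin 2) ℂ) σ₃) ∧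
          ∀ c : Site (F.P J) 0 → Matrix (Fin 2) (Fin 2) ℂ,
            (∀ e : PBond (F.P J) 0, c e.src = ((unitsField (toUField (GaugeField.gaugeAct g V)) e : (Matrix (Fin 2) (Fin 2) ℂ)ˣ) : Matrix (Fin 2) (Fin 2) ℂ) * c e.tgt *
            (((unitsField (toUField (GaugeField.gaugeAct g V)) e)⁻¹ : (Matrix (Fin 2) (Fin 2) ℂ)ˣ) : Matrix (Fin 2) (Fin 2) ℂ)) →
            ∃ c₀ : Matrix (Fin 2) (Fin 2) ℂ, (∀ y, c y = c₀) ∧ Commute c₀ σ₃) →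
        ∀ U₀ ∈ {U' : GaugeField (F.P K) 0 (Matrix.specialUnitaryGroup (Fin 2) ℂ) | U' ∈ fibre F ℰp J K hJK V ∧ U' ∈ histGood F ℰp (θBal F.L γ b₀ p₀) K J ∧
            wilsonAction4 U' = minActionRegPr F J K hJK ε₀ V},
        ∀ U ∈ fibre F ℰp J K hJK V, U ∈ histGood F ℰp (θBal F.L γ b₀ p₀) K J →
          -(∑ p : Plaq (F.P K) 0,
              inner ℝ (imVec (su2Quat (GaugeField.plaqHol U₀ p))) (imVec (su2Quat ((GaugeField.plaqHol U₀ p)⁻¹ * GaugeField.plaqHol U p))))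
            ≤ c * (((F.L : ℝ)⁻¹) ^ (2 * (K - J)) * ∑ ℓ : PBond (F.P K) 0, dist1 (U ℓ * (U₀ ℓ)⁻¹) ^ 2) +
              1 / 4 * ∑ p : Plaq (F.P K) 0, (1 - reTr ((GaugeField.plaqHol U₀ p)⁻¹ * GaugeField.plaqHol U p))) :
    ∀ (L : ℕ), ∃ c₀ : ℝ, 0 < c₀ ∧ c₀ ≤ 1 ∧ ∀ (cw : ℝ), 0 < cw → cw ≤ c₀ → ∃ pS : ℝ, ∀ (b₀ p₀ : ℝ), 0 < b₀ → pS ≤ p₀ → 0 < p₀ → ∃ ε₁ : ℝ, 0 < ε₁ ∧ ∀ (ε₀ : ℝ), 0 < ε₀ → ε₀ ≤ ε₁ →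
    ∃ γ₁ : ℝ, 0 < γ₁ ∧ ∃ μ : ℝ, 0 < μ ∧ ∀ (F : T3Family) (γ : ℝ), F.L = L → 0 < γ → γ ≤ γ₁ →
      ∀ (J K : ℕ) (hJK : J ≤ K) (V : GaugeField (F.P J) 0 (Matrix.specialUnitaryGroup (Fin 2) ℂ)), PlaqSmall (θBal F.L γ (cw * b₀) p₀ J) V →
        ∀ U₀ ∈ {U' : GaugeField (F.P K) 0 (Matrix.specialUnitaryGroup (Fin 2) ℂ) | U' ∈ fibre F ℰp J K hJK V ∧ U' ∈ histGood F ℰp (θBal F.L γ b₀ p₀) K J ∧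
            wilsonAction4 U' = minActionRegPr F J K hJK ε₀ V},
        ∀ U ∈ fibre F ℰp J K hJK V, U ∈ histGood F ℰp (θBal F.L γ b₀ p₀) K J →
          μ * ((F.L : ℝ)⁻¹) ^ (2 * (K - J)) *
              (⨅ w : {w : GaugeTransf (F.P K) 0 (Matrix.specialUnitaryGroup (Fin 2) ℂ) | ∀ U : GaugeField (F.P K) 0 (Matrix.specialUnitaryGroup (Fin 2) ℂ),
                  descendTo F ℰp J K hJK (GaugeField.gaugeAct w U) = descendTo F ℰp J K hJK U}, ∑ ℓ : PBond (F.P K) 0,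
                dist1 (U ℓ * ((GaugeField.gaugeAct (w : GaugeTransf (F.P K) 0 (Matrix.specialUnitaryGroup (Fin 2) ℂ)) U₀) ℓ)⁻¹) ^ 2)
            ≤ wilsonAction4 U - minActionRegPr F J K hJK ε₀ V :=
  uniformFibreGapOrbit_of_strata
    (gapStratum_of_gaugedLetters
      (fun F J V =>
      (∀ c : Site (F.P J) 0 → Matrix (Fin 2) (Fin 2) ℂ,
      (∀ e : PBond (F.P J) 0, c e.src = ((unitsField (toUField V) e : (Matrix (Fin 2) (Fin 2) ℂ)ˣ) : Matrix (Fin 2) (Fin 2) ℂ) * c e.tgt *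
      (((unitsField (toUField V) e)⁻¹ : (Matrix (Fin 2) (Fin 2) ℂ)ˣ) : Matrix (Fin 2) (Fin 2) ℂ)) →
      ∃ z : ℂ, ∀ y, c y = z • (1 : Matrix (Fin 2) (Fin 2) ℂ)))
      hD₁ hF₁)
    (gapStratum_of_gaugedLetters
      (fun F J V =>
      (∃ g : GaugeTransf (F.P J) 0 (Matrix.specialUnitaryGroup (Fin 2) ℂ),
      (∀ e : PBond (F.P J) 0, Commute (((GaugeField.gaugeAct g V) e : Matrix.specialUnitaryGroup (Fin 2) ℂ) : Matrix (Fin 2) (Fin 2) ℂ) σ₃) ∧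
      ∀ c : Site (F.P J) 0 → Matrix (Fin 2) (Fin 2) ℂ,
      (∀ e : PBond (F.P J) 0, c e.src = ((unitsField (toUField (GaugeField.gaugeAct g V)) e : (Matrix (Fin 2) (Fin 2) ℂ)ˣ) : Matrix (Fin 2) (Fin 2) ℂ) * c e.tgt *
      (((unitsField (toUField (GaugeField.gaugeAct g V)) e)⁻¹ : (Matrix (Fin 2) (Fin 2) ℂ)ˣ) : Matrix (Fin 2) (Fin 2) ℂ)) →
      ∃ c₀ : Matrix (Fin 2) (Fin 2) ℂ, (∀ y, c y = c₀) ∧ Commute c₀ σ₃))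
      hD₂ hF₂)

end Summit.QuantumFields.YangMills.Theorems.FluctuationComparisonRegPrIntLS2BetaStrataOfGaugedLetters

end
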